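import Literature.AnabelianGeometry.AbsoluteAnabelian.CuspidalizationFactsModelGalSectInstances
import Literature.AnabelianGeometry.AbsoluteAnabelian.GaloisSectionsFactsLem31LimitOfSections
import Literature.AnabelianGeometry.AbsoluteAnabelian.GaloisSectionsFactsCor32Pointwise
import HarnessLib

/-!
# [GalSect] Lem. 3.1 (i) ⇔ (iv) and Cor. 3.2 (`GalSect.Lem_3_1_i_iff_iv`, `GalSect.Cor_3_2`;
# FACT-LIST F-0101, F-0100): INSTANCE FORMS

S. Mochizuki, *Galois sections in absolute anabelian geometry*, Nagoya Math. J. **179** (2005) 17–45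
[MochizukiGalSect2005]; kurims manuscript pages (`paper:url-1b7afe4e6889`): Lem. 3.1 p. 13 (Criterion for
Galois Sections Associated to Rational Points, (i) ⇔ (iv)), Cor. 3.2 p. 14 (Absoluteness of Decomposition
Groups for Genus Zero).  Cell abc-iut, block F, seat abc-iut-f-053 (gen 4), KEY row INST59H3.  PROOF-ONLY
companion of `GaloisSectionsFacts.lean` (abc-iut-L4-t16; imported, never edited; no definition, no instance).

THE ROWS are the shape-(1) PREDICATES `Lem_3_1_i_iff_iv C P` (cuspidal data `C`, point data `P` over an
extension `E`) and `Cor_3_2 P Q` (point data over two extensions `E`, `F`).  abc-iut-F-lit's kernel census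
(`plan/LF-KERNEL-STATUS.tsv` col. 14, 2026-08-27T12:11Z) sees their closure refuters (abc-iut-f-096
`not_forall_lem_3_1_i_iff_iv`, `not_forall_cor_3_2`) and CONDITIONAL closers only (`lem_3_1_i_iff_iv_of_finite`,
`…_of_isEmpty`, `…_of_decomp_eq_top`; `cor_3_2_of_decomp_eq_top`, `cor_3_2_of_decomp_eq_bot`, `cor_3_2_of_isEmpty`)
— no theorem whose conclusion HEAD is the row at a named datum with 0 hypotheses (the sibling `_model` rows
F-0083/F-0082 got theirs from abc-iut-f-055, `CuspidalizationFactsModelGalSectInstances.lean`).  This file: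

* F-0101 AT THE NAMED TOY INTERFACE `CurveModelSchemaWitness.toyModel k H` (abc-iut-f-076: one curve over `k`,
  `Π := G_k × H ↠ G_k`, one cusp with `D := Π`, one closed point with `D := 1` flagged NF/algebraic):
  `GalSect.lem_3_1_i_iff_iv_toyModel` — by abc-iut-f-096's `lem_3_1_i_iff_iv_of_finite` (finitely many
  points, all algebraic; the limit-of-sections argument).  DEGENERATE, and at this interface ALSO vacuous in
  the section binder (the cusp has `D = Π ⊇ Im(σ)`), which the proof does not use.
* F-0101 over EVERY extension `E` and EVERY cuspidal datum `C`: `GalSect.lem_3_1_i_iff_iv_sectionPoints` — the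
  TAUTOLOGICAL point datum whose points ARE the sections `σ : G_K → Π_{X_K}` of `Π ↠ G`, with `D_σ := Im(σ)`
  (closed: continuous image of a compact group) and every point flagged algebraic: condition (i) holds for
  every section by reflexivity and (iv) follows (`lem_3_1_i_imp_iv`).  A caricature of a curve for which
  "every section is geometric"; non-vacuous in `σ` whenever `Π ↠ G` splits and `C` leaves room — witnessed at
  the point extension with no cusps (`lem_3_1_i_iff_iv_sectionPoints_nonvacuous`).
* F-0100 AT THE NAMED TOY INTERFACES: `GalSect.cor_3_2_toyModel` — between the point data of `toyModel k H` and
  `toyModel k' H'` (ANY two base fields, ANY two profinite `H`, `H'`): every `α : G_k × H ⥲ G_{k'} × H'` carries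
  `{1}` onto `{1}` (abc-iut-f-055's `cor_3_2_of_decomp_eq_bot`).  DEGENERATE (`D = 1`).
* F-0100 over EVERY pair of extensions: `GalSect.cor_3_2_topPoint` (one point each, `D := Π`; f-056's
  `cor_3_2_of_decomp_eq_top`) and the STRUCTURAL instance `GalSect.cor_3_2_closedSubgroupPoints` — the point
  data whose points are ALL CLOSED SUBGROUPS of `Π` (each its own decomposition group): every isomorphism of
  profinite groups carries the closed subgroups of `Π_{X_K}` exactly onto those of `Π_{Y_L}`.  It isolates what
  the typed Cor. 3.2 asks: `α` must respect an EXTERNALLY GIVEN family of subgroups; for any family defined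
  group-theoretically (here: "closed") the predicate is automatic.

HONEST LABEL: every positive instance here is DEGENERATE or TAUTOLOGICAL — statements about OUR typed interface;
the printed Lem. 3.1 / Cor. 3.2 (étale `π₁` of hyperbolic curves over finite extensions of `ℚ_p`, defined over
number fields / isogenous to genus zero) are untouched and remain NAMED INPUTS at the intended instance.
Refuted-as-schema ≠ refuted-in-print; typed ≠ proved; nothing here bears on [IUTchIII] Cor. 3.12; no side taken.
-/

noncomputable section

open scoped Classical Pointwise

namespace Literature.AnabelianGeometry.AbsoluteAnabelian

namespace GalSect

open AbsTopIII

universe u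

variable {E F : FundamentalExtension.{u}}

/-! ### F-0101 at the named toy interface `toyModel k H` -/

/-- **F-0101 AT THE NAMED TOY INTERFACE** `toyModel k H` (`Π := G_k × H ↠ G_k`, one cusp with `D = Π`, one
closed point with `D = 1` flagged algebraic): the typed Lem. 3.1 (i) ⇔ (iv) HOLDS for the toy curve's cuspidal
and point data — finitely many points, all algebraic (`lem_3_1_i_iff_iv_of_finite`).  DEGENERATE toy instance
(also vacuous in `σ` at this interface: `Im(σ) ⊆ Π = D_{cusp}`); the printed Lem. 3.1 is untouched.
[cite: MochizukiGalSect2005, Lem 3.1 p.13] -/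
theorem lem_3_1_i_iff_iv_toyModel (k : Type) [Field k] [CharZero k] (H : ProfiniteGrp.{0})
    (U : (CurveModelSchemaWitness.toyModel k H).Curve)
    (hclosed : ∀ x : (CurveModelSchemaWitness.toyModel k H).Point U,
      IsClosed ((CurveModelSchemaWitness.toyModel k H).decomp U x :
        Set ((CurveModelSchemaWitness.toyModel k H).ext U).arith)) :
    Literature.AnabelianGeometry.AbsoluteAnabelian.GalSect.Lem_3_1_i_iff_iv
      ((CurveModelSchemaWitness.toyModel k H).cusps U)
      (pointDataOf (CurveModelSchemaWitness.toyModel k H) U hclosed) :=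
  haveI : Finite (pointDataOf (CurveModelSchemaWitness.toyModel k H) U hclosed).Point :=
    inferInstanceAs (Finite PUnit)
  lem_3_1_i_iff_iv_of_finite _ _ fun _ => trivial

/-! ### F-0101 over every extension: the tautological "sections are points" datum -/

/-- **F-0101, INSTANCE FORM over every extension `E` and every cuspidal datum `C`** (TAUTOLOGICAL): for the
point datum whose points are the sections `σ` of `Π ↠ G` (`aug ∘ σ = id`), with `D_σ := Im(σ)` (closed) and
every point flagged algebraic, `Lem_3_1_i_iff_iv C P` holds: given a tower and a section `σ` avoiding the
cuspidal decomposition groups, (i) "`Im(σ) = D_x` for some point" holds with `x := σ`, and (iv) follows from (i)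
at an algebraic point (`lem_3_1_i_imp_iv`: `D_σ = Im(σ) ⊆ Π[j, σ]` surjects onto `G`).  Consistency of the
typing with a large point set; nothing about curves. [cite: MochizukiGalSect2005, Lem 3.1 p.13] -/
theorem lem_3_1_i_iff_iv_sectionPoints (E : FundamentalExtension.{u}) (C : E.CuspidalData) :
    Literature.AnabelianGeometry.AbsoluteAnabelian.GalSect.Lem_3_1_i_iff_iv C
      (⟨{σ : E.gal →ₜ* E.arith // ∀ g, E.aug (σ g) = g}, fun σ => σ.1.toMonoidHom.range,
        fun σ => by
          rw [MonoidHom.coe_range]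
          exact (isCompact_range (map_continuous σ.1)).isClosed,
        fun _ => True⟩ : PointData E) := by
  intro Δj _ σ hσ _
  have hi : σ.toMonoidHom.range =
      MulAut.conj (1 : E.arith) • (⟨σ, hσ⟩ : {σ : E.gal →ₜ* E.arith // ∀ g, E.aug (σ g) = g}).1.toMonoidHom.range := by
    rw [map_one, one_smul]
  exact iff_of_true ⟨⟨σ, hσ⟩, 1, hi⟩ fun j => lem_3_1_i_imp_iv _ Δj σ hσ hi trivial j

/-- **Non-vacuity of `lem_3_1_i_iff_iv_sectionPoints`** at the point extension `Π := G ↠ G` (identity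
augmentation; any profinite `G`, e.g. `G_{ℚ_p}`) with NO cusps: the constant tower `1` is characteristic, the
identity section is a section avoiding the (absent) cuspidal decomposition groups, and it is a point of the
sections-datum — so at these data the proved equivalence (i) ⇔ (iv) is asserted of an actual section, with (i)
and (iv) both true.  TOY data. [cite: MochizukiGalSect2005, Lem 3.1 p.13] -/
theorem lem_3_1_i_iff_iv_sectionPoints_nonvacuous (G : ProfiniteGrp.{u}) :
    ∃ (E : FundamentalExtension.{u}) (C : E.CuspidalData) (Δj : ℕ → Subgroup E.geom) (σ : E.gal →ₜ* E.arith),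
      IsCharacteristicTower E Δj ∧ (∀ g, E.aug (σ g) = g) ∧
        (∀ (c : C.Cusp) (g : E.arith), ¬ σ.toMonoidHom.range ≤ MulAut.conj g • C.Dcusp c) ∧
          Nonempty {σ : E.gal →ₜ* E.arith // ∀ g, E.aug (σ g) = g} := by
  let E : FundamentalExtension.{u} :=
    { arith := G, gal := G, aug := ContinuousMonoidHom.id _, aug_surjective := Function.surjective_id }
  let C : E.CuspidalData :=
    { Cusp := PEmpty
      Dcusp := fun c => nomatch c
      Icusp := fun c => nomatch c
      Icusp_eq := fun c => nomatch c
      isClosed_Dcusp := fun c => nomatch c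
      eq_of_conj := fun c => nomatch c }
  have haug : Function.Injective E.aug := Function.injective_id
  refine ⟨E, C, fun _ => ⊥, ContinuousMonoidHom.id _, isCharacteristicTower_bot_of_aug_injective haug,
    fun _ => rfl, ?_, ⟨⟨ContinuousMonoidHom.id _, fun _ => rfl⟩⟩⟩
  intro c
  exact nomatch c

/-! ### F-0100 at the named toy interfaces -/

/-- **F-0100 AT THE NAMED TOY INTERFACES** `toyModel k H`, `toyModel k' H'` (ANY two base fields of
characteristic zero, ANY two profinite groups): `Cor_3_2` holds between their point data — both have one closed
point with `D = 1`, and every `α : G_k × H ⥲ G_{k'} × H'` carries `{1}` onto `{1}` (`cor_3_2_of_decomp_eq_bot`).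
DEGENERATE toy instance; the printed Cor. 3.2 is untouched. [cite: MochizukiGalSect2005, Cor 3.2 p.14] -/
theorem cor_3_2_toyModel (k : Type) [Field k] [CharZero k] (H : ProfiniteGrp.{0})
    (k' : Type) [Field k'] [CharZero k'] (H' : ProfiniteGrp.{0})
    (U : (CurveModelSchemaWitness.toyModel k H).Curve) (V : (CurveModelSchemaWitness.toyModel k' H').Curve)
    (hU : ∀ x : (CurveModelSchemaWitness.toyModel k H).Point U,
      IsClosed ((CurveModelSchemaWitness.toyModel k H).decomp U x :
        Set ((CurveModelSchemaWitness.toyModel k H).ext U).arith))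
    (hV : ∀ y : (CurveModelSchemaWitness.toyModel k' H').Point V,
      IsClosed ((CurveModelSchemaWitness.toyModel k' H').decomp V y :
        Set ((CurveModelSchemaWitness.toyModel k' H').ext V).arith)) :
    Literature.AnabelianGeometry.AbsoluteAnabelian.GalSect.Cor_3_2
      (pointDataOf (CurveModelSchemaWitness.toyModel k H) U hU)
      (pointDataOf (CurveModelSchemaWitness.toyModel k' H') V hV) :=
  haveI : Nonempty (pointDataOf (CurveModelSchemaWitness.toyModel k H) U hU).Point := ⟨PUnit.unit⟩
  haveI : Nonempty (pointDataOf (CurveModelSchemaWitness.toyModel k' H') V hV).Point := ⟨PUnit.unit⟩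
  cor_3_2_of_decomp_eq_bot _ _ (fun _ => rfl) (fun _ => rfl)

/-! ### F-0100 over every pair of extensions -/

/-- **F-0100, INSTANCE FORM over every pair of extensions** (DEGENERATE): one closed point on each side with
`D := Π`; every `α : Π_{X_K} ⥲ Π_{Y_L}` carries `{Π_{X_K}}` onto `{Π_{Y_L}}` (`cor_3_2_of_decomp_eq_top`).
[cite: MochizukiGalSect2005, Cor 3.2 p.14] -/
theorem cor_3_2_topPoint (E F : FundamentalExtension.{u}) :
    Literature.AnabelianGeometry.AbsoluteAnabelian.GalSect.Cor_3_2
      (⟨PUnit.{u + 1}, fun _ => ⊤, fun _ => by rw [Subgroup.coe_top]; exact isClosed_univ, fun _ => True⟩ :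
        PointData E)
      (⟨PUnit.{u + 1}, fun _ => ⊤, fun _ => by rw [Subgroup.coe_top]; exact isClosed_univ, fun _ => True⟩ :
        PointData F) :=
  cor_3_2_of_decomp_eq_top _ _ (fun _ => rfl) (fun _ => rfl)

/-- The image of a closed subgroup under an isomorphism of profinite groups is closed (compact image in a
Hausdorff group). [cite: MochizukiGalSect2005, Cor 3.2 p.14] -/
theorem isClosed_map_of_isClosed (α : E.arith ≃ₜ* F.arith) {D : Subgroup E.arith}
    (hD : IsClosed (D : Set E.arith)) : IsClosed (D.map α.toMonoidHom : Set F.arith) := by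
  rw [Subgroup.coe_map]
  exact (hD.isCompact.image α.continuous).isClosed

/-- A conjugate of a closed subgroup is closed. [cite: MochizukiGalSect2005, §1 p.6] -/
theorem isClosed_conj_smul_of_isClosed (g : E.arith) {D : Subgroup E.arith} (hD : IsClosed (D : Set E.arith)) :
    IsClosed ((MulAut.conj g • D : Subgroup E.arith) : Set E.arith) := by
  have h : ((MulAut.conj g • D : Subgroup E.arith) : Set E.arith) = (fun x => g * x * g⁻¹) '' (D : Set E.arith) := by
    rw [Subgroup.coe_pointwise_smul]
    ext y
    simp only [Set.mem_smul_set, Set.mem_image, MulAut.smul_def, MulAut.conj_apply]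
  rw [h]
  exact (hD.isCompact.image ((continuous_const.mul continuous_id).mul continuous_const)).isClosed

/-- For the "all closed subgroups" point datum the set of decomposition groups IS the set of closed subgroups
(conjugates of closed subgroups are closed). [cite: MochizukiGalSect2005, §1 p.6] -/
theorem decompositionGroups_closedSubgroupPoints (E : FundamentalExtension.{u}) :
    (⟨{D : Subgroup E.arith // IsClosed (D : Set E.arith)}, Subtype.val, fun D => D.2, fun _ => True⟩ :
        PointData E).decompositionGroups = {D : Subgroup E.arith | IsClosed (D : Set E.arith)} := by
  ext D
  simp only [PointData.decompositionGroups, Set.mem_setOf_eq]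
  constructor
  · rintro ⟨x, g, rfl⟩
    exact isClosed_conj_smul_of_isClosed g x.2
  · intro hD
    exact ⟨⟨D, hD⟩, 1, by rw [map_one, one_smul]⟩

/-- **F-0100, STRUCTURAL INSTANCE FORM over every pair of extensions**: for the point data whose points are
ALL CLOSED SUBGROUPS of `Π_{X_K}`, resp. of `Π_{Y_L}` (each being its own decomposition group, flagged
algebraic), `Cor_3_2` holds: every isomorphism of profinite groups `α : Π_{X_K} ⥲ Π_{Y_L}` carries the closed
subgroups of the source exactly onto the closed subgroups of the target (`α`, `α⁻¹` are homeomorphisms).  Reading: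
the typed Cor. 3.2 constrains `α` only through an EXTERNALLY given family of "decomposition groups"; for a
family cut out group-theoretically it is automatic.  TAUTOLOGICAL; nothing about curves.
[cite: MochizukiGalSect2005, Cor 3.2 p.14] -/
theorem cor_3_2_closedSubgroupPoints (E F : FundamentalExtension.{u}) :
    Literature.AnabelianGeometry.AbsoluteAnabelian.GalSect.Cor_3_2
      (⟨{D : Subgroup E.arith // IsClosed (D : Set E.arith)}, Subtype.val, fun D => D.2, fun _ => True⟩ :
        PointData E)
      (⟨{D : Subgroup F.arith // IsClosed (D : Set F.arith)}, Subtype.val, fun D => D.2, fun _ => True⟩ :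
        PointData F) := by
  intro α
  rw [decompositionGroups_closedSubgroupPoints E, decompositionGroups_closedSubgroupPoints F]
  ext D'
  simp only [Set.mem_image, Set.mem_setOf_eq]
  constructor
  · rintro ⟨D, hD, rfl⟩
    exact isClosed_map_of_isClosed α hD
  · intro hD'
    exact ⟨D'.map α.symm.toMonoidHom, isClosed_map_of_isClosed α.symm hD', map_symm_map α D'⟩

end GalSect

end Literature.AnabelianGeometry.AbsoluteAnabelian

end
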